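import Summits.CriticalPhenomena.PercolationContinuityZ3.Theorems.PercNearOneGluingNoHeavyQuantDIBOneLightAll
import Summits.CriticalPhenomena.PercolationContinuityZ3.Theorems.PercNearOneGluingNoHeavyQuantIndepBlobGroupRaise
import Summits.CriticalPhenomena.PercolationContinuityZ3.Theorems.PercNearOneGluingNoHeavyQuantIndepBlobGapCalculus
import Summits.CriticalPhenomena.PercolationContinuityZ3.Theorems.PercNearOneGluingNoHeavyQuantRootReduction
import HarnessLib

/-!
# QUANT lane R8, Conjecture DIB\* — CLOUD CONDITIONING and the COMPONENT ROW: a light cloud acts on the tail only through the law of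
# its mass, and every certified component 'sure `lo` + one blob `(hi − lo, γ)`' of that law is a one-light instance (part I of the
# small-cloud theorem `…QuantIndepBlobSmallCloud`)

builds on p205010 (kernel theorem, internal audit signed; external expert review pending)

Support file (`--supports stmt-CriticalPhenomena-4575`), QUANT lane census seat prim-quant-census-1 (gen 15), rung R8 of
`run/shared/lean/prim/quant/LADDER.md`; memo `run/shared/lean/prim/quant/prim-quant-census-1/SMALL-CLOUD-G15.md`.
Theorems only, no definitions, no sorries, standard axioms.

SETTING.  Blobs `k : κ` with sizes `a k ∈ ℕ` and gates `p k ∈ [0,1]`; a CLOUD is a finset `L` of blobs, the other blobs being heavy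
(`x ≤ p k` off `L`); restricted weights / tails `TL_U(t) = Σ_{T ⊆ U} w_U(T)·𝟙[t ≤ a(T)]` as in the lead's gap calculus
(`…QuantIndepBlobGapCalculus`).  A COMPONENT is a triple `(lo, hi, γ)` (`lo ≤ hi`, gate `γ ∈ [0,1]`): the two-point law 'sure mass `lo`
plus one blob of size `hi − lo` at gate `γ`'.  Its DIB\*-credit against the heavy budget is `2·lo + (hi − lo)·γ` if `x ≤ γ` and
`2·lo + (hi − lo)·(γ − x²)/(1 − x)` if `γ < x` (the light rate `κ_x` of `Quant.IndepBlob.DIBStar`).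

* `Quant.IndepBlob.sum_weight_cloud_split`, `tail_cloud_split` — **CLOUD CONDITIONING**: `P(N ≥ t) = Σ_{S ⊆ L} w_L(S)·TL_{Lᶜ}(t − a(S))`
  (from census-1 g12's `sum_weight_set_split`); `sum_powerset_weight_mul_mass` — the cloud mass has mean `Σ_{k ∈ L} a k·p k`;
  `sum_TP_mul` — integrating a two-point law.
* `Quant.IndepBlob.cloudCredit_le_component` — **THE CREDIT INEQUALITY**: for a mean-preserving component (`(1 − γ)lo + γ·hi = m`,
  `hi ≤ M`, `m ≤ x·M`) the cloud credit `(m − x²·M)/(1 − x)` is at most the component credit (heavy case: `≤ m ≤ lo + m`; light case: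
  slack `lo(1 − x)² + x²(M − hi) ≥ 0`).
* `Quant.IndepBlob.cloud_component_row` — **THE COMPONENT ROW**: floor `0 < x < 1`, `lo ≤ hi ≤ j`, credit
  `2j < Σ_{k ∉ L} a k·p k + (component credit)` ⟹ `x ≤ γ·TL_{Lᶜ}(j+1−hi) + (1 − γ)·TL_{Lᶜ}(j+1−lo)`.  The right-hand side is the tail
  at layer `j − lo` of the heavy blobs plus ONE blob `(hi − lo, γ)`, realised on the same index type (the blob carried by one index
  `ℓ₀ ∈ L`, the other cloud indices emptied at gate `1`), hence an instance of census-1 g14's `IndepBlob.dib_oneLight` (`γ < x`) or of the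
  heavy + sure row `RootDec.term_ge_of_budget` (`x ≤ γ`).  By linearity of the tail in the cloud law (`tail_cloud_split`), ANY
  decomposition of the cloud law into certified components proves the DIB\* row — the LIGHT-DEC reduction of the memo (§3: LP-feasible
  on every one of 29 000 + 217 exact corner clouds); part (II) uses the mean-preserving decomposition for clouds of size `≤ j`.

[this work; this lane's census]; the gluing rows served: [cite: KozmaNitzan2024, Conjecture 3 (p. 15)]; product weights
[cite: Grimmett1999, §1.3 p. 10].
-/

namespace Summit.CriticalPhenomena.PercolationContinuityZ3.Theorems

namespace Quant

namespace IndepBlob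

open Finset

variable {κ : Type*} [Fintype κ] [DecidableEq κ]

/-! ### 1. Cloud conditioning and the law of the cloud mass -/

/-- **Cloud conditioning** (expectation form): for a finset `L` of blobs and any `F : ℕ → ℝ`,
`E F(N) = Σ_{S ⊆ L} w_L(S)·Σ_{T ⊆ Lᶜ} w_{Lᶜ}(T)·F(a(S) + a(T))`. [folklore] -/
theorem sum_weight_cloud_split (p : κ → ℝ) (a : κ → ℕ) (L : Finset κ) (F : ℕ → ℝ) :
    ∑ s : Finset κ, (∏ k, if k ∈ s then p k else 1 - p k) * F (∑ k ∈ s, a k) =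
      ∑ S ∈ L.powerset, (∏ k ∈ L, if k ∈ S then p k else 1 - p k) *
        ∑ T ∈ (Finset.univ \ L).powerset, (∏ k ∈ Finset.univ \ L, if k ∈ T then p k else 1 - p k) *
          F (∑ k ∈ S, a k + ∑ k ∈ T, a k) := by
  rw [sum_weight_set_split p L (fun s => F (∑ k ∈ s, a k))]
  refine Finset.sum_congr rfl fun S hS => ?_
  rw [Finset.mul_sum]
  refine Finset.sum_congr rfl fun T hT => ?_
  have hSL : S ⊆ L := Finset.mem_powerset.1 hS
  have hTU : T ⊆ Finset.univ \ L := Finset.mem_powerset.1 hT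
  have hdisj : Disjoint S T := by
    refine Finset.disjoint_left.2 fun k hkS hkT => ?_
    exact (Finset.mem_sdiff.1 (hTU hkT)).2 (hSL hkS)
  rw [Finset.sum_union hdisj]

/-- **Cloud conditioning** (tail form): `P(N ≥ t) = Σ_{S ⊆ L} w_L(S)·TL_{Lᶜ}(t − a(S))` (truncated subtraction; `TL(0) = 1`). [folklore] -/
theorem tail_cloud_split (p : κ → ℝ) (a : κ → ℕ) (L : Finset κ) (t : ℕ) :
    ∑ s : Finset κ, (∏ k, if k ∈ s then p k else 1 - p k) * (if t ≤ ∑ k ∈ s, a k then (1 : ℝ) else 0) =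
      ∑ S ∈ L.powerset, (∏ k ∈ L, if k ∈ S then p k else 1 - p k) *
        ∑ T ∈ (Finset.univ \ L).powerset, (∏ k ∈ Finset.univ \ L, if k ∈ T then p k else 1 - p k) *
          (if t - ∑ k ∈ S, a k ≤ ∑ k ∈ T, a k then (1 : ℝ) else 0) := by
  rw [sum_weight_cloud_split p a L (fun n => if t ≤ n then (1 : ℝ) else 0)]
  refine Finset.sum_congr rfl fun S _ => ?_
  congr 1
  refine Finset.sum_congr rfl fun T _ => ?_
  simp only [tsub_le_iff_left]

omit [Fintype κ] in
/-- **Mean of the cloud mass**: `Σ_{S ⊆ L} w_L(S)·a(S) = Σ_{k ∈ L} a k·p k`. [folklore] -/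
theorem sum_powerset_weight_mul_mass (p : κ → ℝ) (a : κ → ℕ) (L : Finset κ) :
    ∑ S ∈ L.powerset, (∏ k ∈ L, if k ∈ S then p k else 1 - p k) * ((∑ k ∈ S, a k : ℕ) : ℝ) =
      ∑ k ∈ L, (a k : ℝ) * p k := by
  induction L using Finset.induction_on with
  | empty => simp
  | @insert k L hk ih =>
    rw [sum_powerset_weight_insert p L k hk (fun S => ((∑ i ∈ S, a i : ℕ) : ℝ)), Finset.sum_insert hk]
    have h1 : ∑ S ∈ L.powerset, (∏ i ∈ L, if i ∈ S then p i else 1 - p i) * ((∑ i ∈ insert k S, a i : ℕ) : ℝ) =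
        ∑ S ∈ L.powerset, (∏ i ∈ L, if i ∈ S then p i else 1 - p i) * ((∑ i ∈ S, a i : ℕ) : ℝ) +
          (a k : ℝ) * ∑ S ∈ L.powerset, (∏ i ∈ L, if i ∈ S then p i else 1 - p i) := by
      rw [Finset.mul_sum, ← Finset.sum_add_distrib]
      refine Finset.sum_congr rfl fun S hS => ?_
      have hkS : k ∉ S := fun h => hk (Finset.mem_powerset.1 hS h)
      rw [Finset.sum_insert hkS, Nat.cast_add]
      ring
    rw [h1, ih, sum_powerset_weight]
    ring

/-- Integrating a two-point law against a function: `Σ_h TP[lo, hi, γ](h)·ψ h = γ·ψ hi + (1 − γ)·ψ lo` (atoms in the range). [folklore] -/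
theorem sum_TP_mul (R : Finset ℕ) (lo hi : ℕ) (hlo : lo ∈ R) (hhi : hi ∈ R) (γ : ℝ) (ψ : ℕ → ℝ) :
    ∑ h ∈ R, (γ * (if h = hi then (1 : ℝ) else 0) + (1 - γ) * (if h = lo then (1 : ℝ) else 0)) * ψ h =
      γ * ψ hi + (1 - γ) * ψ lo := by
  have e : ∀ h ∈ R, (γ * (if h = hi then (1 : ℝ) else 0) + (1 - γ) * (if h = lo then (1 : ℝ) else 0)) * ψ h =
      (if h = hi then γ * ψ h else 0) + (if h = lo then (1 - γ) * ψ h else 0) := by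
    intro h _
    split_ifs <;> ring
  rw [Finset.sum_congr rfl e, Finset.sum_add_distrib, Finset.sum_ite_eq' R hi, Finset.sum_ite_eq' R lo, if_pos hhi, if_pos hlo]

/-! ### 2. The credit inequality and the component row -/

/-- **The cloud credit is at most every mean-preserving component's credit.**  For `0 < x < 1`, `0 ≤ lo ≤ hi ≤ M`, `γ ≥ 0`,
`(1 − γ)·lo + γ·hi = m ≤ x·M`:  `(m − x² M)/(1 − x) ≤ 2·lo + (hi − lo)·(γ if x ≤ γ, else (γ − x²)/(1 − x))`.
Heavy case: `(m − x²M)/(1 − x) ≤ m ≤ lo + m`; light case: slack `lo(1 − x)² + x²(M − hi) ≥ 0`. [this work] -/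
theorem cloudCredit_le_component (x m M lo hi γ : ℝ) (hx0 : 0 < x) (hx1 : x < 1) (hlo : 0 ≤ lo) (hlohi : lo ≤ hi)
    (hhiM : hi ≤ M) (hγ0 : 0 ≤ γ) (hmean : (1 - γ) * lo + γ * hi = m) (hm : m ≤ x * M) :
    (m - x ^ 2 * M) / (1 - x) ≤ 2 * lo + (hi - lo) * (if x ≤ γ then γ else (γ - x ^ 2) / (1 - x)) := by
  have h1x : 0 < 1 - x := by linarith
  have hm' : m = lo + (hi - lo) * γ := by rw [← hmean]; ring
  by_cases hγ : x ≤ γ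
  · rw [if_pos hγ, div_le_iff₀ h1x]
    have h1 : x * m ≤ x * (x * M) := mul_le_mul_of_nonneg_left hm hx0.le
    have h2 : 0 ≤ lo * (1 - x) := mul_nonneg hlo h1x.le
    have h3 : 0 ≤ (hi - lo) * γ := mul_nonneg (sub_nonneg.2 hlohi) hγ0
    nlinarith
  · rw [if_neg hγ, mul_div_assoc', div_le_iff₀ h1x, add_mul, div_mul_cancel₀ _ h1x.ne']
    have h1 : 0 ≤ x ^ 2 * (M - hi) := mul_nonneg (sq_nonneg x) (sub_nonneg.2 hhiM)
    have h2 : 0 ≤ lo * (1 - x) ^ 2 := mul_nonneg hlo (sq_nonneg _)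
    nlinarith

/-- **THE COMPONENT ROW.**  Gates in `[0,1]`, floor `0 < x < 1`, a finset `L` (the cloud's indices, `ℓ₀ ∈ L`) off which every blob is
heavy; integers `lo ≤ hi ≤ j` and a gate `γ ∈ [0,1]` with `2j < Σ_{k ∉ L} a k·p k + 2·lo + (hi − lo)·(γ | (γ − x²)/(1 − x))`.  Then
`x ≤ γ·TL_{Lᶜ}(j+1−hi) + (1 − γ)·TL_{Lᶜ}(j+1−lo)`: the right-hand side is the tail at layer `j − lo` of the heavy blobs plus ONE blob
`(hi − lo, γ)` (carried by `ℓ₀`, the other indices of `L` emptied), an instance of `IndepBlob.dib_oneLight` (`γ < x`) or of the heavy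
row `RootDec.term_ge_of_budget` (`x ≤ γ`). [this work] -/
theorem cloud_component_row (p : κ → ℝ) (a : κ → ℕ) (x : ℝ) (hx0 : 0 < x) (hx1 : x < 1)
    (hp0 : ∀ k, 0 ≤ p k) (hp1 : ∀ k, p k ≤ 1) (L : Finset κ) (ℓ₀ : κ) (hℓ₀ : ℓ₀ ∈ L)
    (hheavy : ∀ k, k ∉ L → x ≤ p k) (j lo hi : ℕ) (γ : ℝ) (hγ0 : 0 ≤ γ) (hγ1 : γ ≤ 1)
    (hlohi : lo ≤ hi) (hhij : hi ≤ j)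
    (hcredit : (2 * j : ℝ) < (∑ k ∈ Finset.univ \ L, (a k : ℝ) * p k) + 2 * lo +
      ((hi - lo : ℕ) : ℝ) * (if x ≤ γ then γ else (γ - x ^ 2) / (1 - x))) :
    x ≤ γ * (∑ T ∈ (Finset.univ \ L).powerset, (∏ k ∈ Finset.univ \ L, if k ∈ T then p k else 1 - p k) *
            (if j + 1 - hi ≤ ∑ k ∈ T, a k then (1 : ℝ) else 0)) +
        (1 - γ) * (∑ T ∈ (Finset.univ \ L).powerset, (∏ k ∈ Finset.univ \ L, if k ∈ T then p k else 1 - p k) *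
            (if j + 1 - lo ≤ ∑ k ∈ T, a k then (1 : ℝ) else 0)) := by
  set U : Finset κ := Finset.univ \ L with hU
  set TL : ℕ → ℝ := fun t => ∑ T ∈ U.powerset, (∏ k ∈ U, if k ∈ T then p k else 1 - p k) *
      (if t ≤ ∑ k ∈ T, a k then (1 : ℝ) else 0) with hTL
  change x ≤ γ * TL (j + 1 - hi) + (1 - γ) * TL (j + 1 - lo)
  set b : ℕ := hi - lo with hb
  have hloj : lo ≤ j := hlohi.trans hhij
  have hmemU : ∀ k, k ∈ U ↔ k ∉ L := fun k => by simp [hU]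
  -- the modified system: the cloud replaced by ONE blob `(b, γ)` carried by `ℓ₀`, the other cloud indices emptied (gate 1)
  set a' : κ → ℕ := fun k => if k = ℓ₀ then b else if k ∈ L then 0 else a k with ha'
  set g' : κ → ℝ := fun k => if k = ℓ₀ then γ else if k ∈ L then 1 else p k with hg'
  have hg'01 : ∀ k, 0 ≤ g' k ∧ g' k ≤ 1 := by
    intro k
    simp only [hg']
    split_ifs
    · exact ⟨hγ0, hγ1⟩
    · exact ⟨zero_le_one, le_rfl⟩
    · exact ⟨hp0 k, hp1 k⟩
  have ha'ℓ : a' ℓ₀ = b := by simp [ha']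
  have hg'ℓ : g' ℓ₀ = γ := by simp [hg']
  have hU_a : ∀ k ∈ U, a' k = a k := by
    intro k hk
    have hkL : k ∉ L := (hmemU k).1 hk
    have hkℓ : k ≠ ℓ₀ := fun h => hkL (h ▸ hℓ₀)
    simp [ha', hkL, hkℓ]
  have hU_g : ∀ k ∈ U, g' k = p k := by
    intro k hk
    have hkL : k ∉ L := (hmemU k).1 hk
    have hkℓ : k ≠ ℓ₀ := fun h => hkL (h ▸ hℓ₀)
    simp [hg', hkL, hkℓ]
  have hL_a : ∀ k ∈ L, k ≠ ℓ₀ → a' k = 0 := by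
    intro k hk hkℓ
    simp [ha', hk, hkℓ]
  have hL_g : ∀ k ∈ L, k ≠ ℓ₀ → g' k = 1 := by
    intro k hk hkℓ
    simp [hg', hk, hkℓ]
  -- the total budget of the modified system
  have hbudget_tot : ∑ k, (a' k : ℝ) * g' k = (∑ k ∈ U, (a k : ℝ) * p k) + (b : ℝ) * γ := by
    rw [← Finset.sum_sdiff (Finset.subset_univ L)]
    have h1 : ∑ k ∈ Finset.univ \ L, (a' k : ℝ) * g' k = ∑ k ∈ U, (a k : ℝ) * p k :=
      Finset.sum_congr rfl fun k hk => by rw [hU_a k hk, hU_g k hk]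
    have h2 : ∑ k ∈ L, (a' k : ℝ) * g' k = ∑ k ∈ L, (if k = ℓ₀ then (b : ℝ) * γ else 0) := by
      refine Finset.sum_congr rfl fun k hk => ?_
      by_cases hkℓ : k = ℓ₀
      · rw [if_pos hkℓ, hkℓ, ha'ℓ, hg'ℓ]
      · rw [if_neg hkℓ, hL_a k hk hkℓ, Nat.cast_zero, zero_mul]
    rw [h1, h2, Finset.sum_ite_eq' L ℓ₀, if_pos hℓ₀]
  have hbudget_erase : ∑ k ∈ (Finset.univ : Finset κ).erase ℓ₀, (a' k : ℝ) * g' k = ∑ k ∈ U, (a k : ℝ) * p k := by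
    rw [Finset.sum_erase_eq_sub (Finset.mem_univ ℓ₀), hbudget_tot, ha'ℓ, hg'ℓ]
    ring
  -- THE IDENTITY: the modified tail at layer `j − lo` is the two-level combination of the heavy restricted tails
  have hinner : ∀ S ∈ L.powerset,
      ∑ T ∈ (Finset.univ \ L).powerset, (∏ k ∈ Finset.univ \ L, if k ∈ T then g' k else 1 - g' k) *
          (if j + 1 ≤ lo + ∑ k ∈ S ∪ T, a' k then (1 : ℝ) else 0) =
        if ℓ₀ ∈ S then TL (j + 1 - hi) else TL (j + 1 - lo) := by
    intro S hS
    have hSL : S ⊆ L := Finset.mem_powerset.1 hS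
    have hSa : ∑ k ∈ S, a' k = if ℓ₀ ∈ S then b else 0 := by
      have e : ∀ k ∈ S, a' k = if k = ℓ₀ then b else 0 := by
        intro k hk
        by_cases hkℓ : k = ℓ₀
        · rw [if_pos hkℓ, hkℓ, ha'ℓ]
        · rw [if_neg hkℓ, hL_a k (hSL hk) hkℓ]
      rw [Finset.sum_congr rfl e, Finset.sum_ite_eq' S ℓ₀]
    have hT : ∀ T ∈ (Finset.univ \ L).powerset,
        (∏ k ∈ Finset.univ \ L, if k ∈ T then g' k else 1 - g' k) *
            (if j + 1 ≤ lo + ∑ k ∈ S ∪ T, a' k then (1 : ℝ) else 0) =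
          (∏ k ∈ U, if k ∈ T then p k else 1 - p k) *
            (if j + 1 - (lo + (if ℓ₀ ∈ S then b else 0)) ≤ ∑ k ∈ T, a k then (1 : ℝ) else 0) := by
      intro T hT
      have hTU : T ⊆ U := Finset.mem_powerset.1 hT
      have hdisj : Disjoint S T := by
        refine Finset.disjoint_left.2 fun k hkS hkT => ?_
        exact ((hmemU k).1 (hTU hkT)) (hSL hkS)
      have hw : (∏ k ∈ Finset.univ \ L, if k ∈ T then g' k else 1 - g' k) = ∏ k ∈ U, if k ∈ T then p k else 1 - p k :=
        Finset.prod_congr rfl fun k hk => by rw [hU_g k hk]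
      have hTa : ∑ k ∈ T, a' k = ∑ k ∈ T, a k := Finset.sum_congr rfl fun k hk => hU_a k (hTU hk)
      rw [hw, Finset.sum_union hdisj, hSa, hTa]
      congr 1
      have hiff : (j + 1 ≤ lo + ((if ℓ₀ ∈ S then b else 0) + ∑ k ∈ T, a k)) ↔
          (j + 1 - (lo + (if ℓ₀ ∈ S then b else 0)) ≤ ∑ k ∈ T, a k) := by
        rw [tsub_le_iff_left, add_assoc]
      simp only [hiff]
    rw [Finset.sum_congr rfl hT]
    by_cases hS0 : ℓ₀ ∈ S
    · simp only [hS0, if_true]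
      have : lo + b = hi := by omega
      rw [this]
    · simp only [hS0, if_false, add_zero]
      rfl
  have hcond : ∀ G₁ G₀ : ℝ, ∑ S ∈ L.powerset, (∏ k ∈ L, if k ∈ S then g' k else 1 - g' k) * (if ℓ₀ ∈ S then G₁ else G₀) =
      γ * G₁ + (1 - γ) * G₀ := by
    intro G₁ G₀
    have hLe : L = insert ℓ₀ (L.erase ℓ₀) := (Finset.insert_erase hℓ₀).symm
    rw [hLe, sum_powerset_weight_insert g' (L.erase ℓ₀) ℓ₀ (Finset.notMem_erase ℓ₀ L) (fun S => if ℓ₀ ∈ S then G₁ else G₀)]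
    have h1 : ∑ S ∈ (L.erase ℓ₀).powerset, (∏ i ∈ L.erase ℓ₀, if i ∈ S then g' i else 1 - g' i) *
        (if ℓ₀ ∈ insert ℓ₀ S then G₁ else G₀) = G₁ := by
      have e : ∀ S ∈ (L.erase ℓ₀).powerset, (∏ i ∈ L.erase ℓ₀, if i ∈ S then g' i else 1 - g' i) *
          (if ℓ₀ ∈ insert ℓ₀ S then G₁ else G₀) = (∏ i ∈ L.erase ℓ₀, if i ∈ S then g' i else 1 - g' i) * G₁ := by
        intro S _
        rw [if_pos (Finset.mem_insert_self ℓ₀ S)]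
      rw [Finset.sum_congr rfl e, ← Finset.sum_mul, sum_powerset_weight, one_mul]
    have h0 : ∑ S ∈ (L.erase ℓ₀).powerset, (∏ i ∈ L.erase ℓ₀, if i ∈ S then g' i else 1 - g' i) *
        (if ℓ₀ ∈ S then G₁ else G₀) = G₀ := by
      have e : ∀ S ∈ (L.erase ℓ₀).powerset, (∏ i ∈ L.erase ℓ₀, if i ∈ S then g' i else 1 - g' i) *
          (if ℓ₀ ∈ S then G₁ else G₀) = (∏ i ∈ L.erase ℓ₀, if i ∈ S then g' i else 1 - g' i) * G₀ := by
        intro S hS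
        have : ℓ₀ ∉ S := fun h => Finset.notMem_erase ℓ₀ L (Finset.mem_powerset.1 hS h)
        rw [if_neg this]
      rw [Finset.sum_congr rfl e, ← Finset.sum_mul, sum_powerset_weight, one_mul]
    rw [h1, h0, hg'ℓ]
  have hident : ∑ W : Finset κ, (∏ k, if k ∈ W then g' k else 1 - g' k) *
      (if j + 1 ≤ lo + ∑ k ∈ W, a' k then (1 : ℝ) else 0) = γ * TL (j + 1 - hi) + (1 - γ) * TL (j + 1 - lo) := by
    rw [sum_weight_set_split g' L (fun W => if j + 1 ≤ lo + ∑ k ∈ W, a' k then (1 : ℝ) else 0)]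
    rw [← hcond (TL (j + 1 - hi)) (TL (j + 1 - lo))]
    refine Finset.sum_congr rfl fun S hS => ?_
    rw [← Finset.mul_sum, hinner S hS]
  -- the two cases
  by_cases hγx : x ≤ γ
  · -- heavy component: the heavy + sure row
    rw [if_pos hγx] at hcredit
    have hfloor : ∀ k, a' k ≠ 0 → x ≤ g' k := by
      intro k hk
      by_cases hkℓ : k = ℓ₀
      · rw [hkℓ, hg'ℓ]; exact hγx
      · by_cases hkL : k ∈ L
        · exact absurd (hL_a k hkL hkℓ) hk
        · rw [hU_g k ((hmemU k).2 hkL)]; exact hheavy k hkL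
    have hbudget : (2 * j : ℝ) < 2 * lo + ∑ k, (a' k : ℝ) * g' k := by
      rw [hbudget_tot]
      have : ((hi - lo : ℕ) : ℝ) = (b : ℝ) := by rw [hb]
      rw [this] at hcredit
      linarith
    have key := RootDec.term_ge_of_budget lo a' g' j x hx1.le hg'01 hfloor hbudget
    rw [hident] at key
    exact key
  · -- light component: `dib_oneLight` at layer `j − lo`
    rw [if_neg hγx] at hcredit
    have hγlt : g' ℓ₀ < x := by rw [hg'ℓ]; exact not_le.1 hγx
    have haℓ : a' ℓ₀ ≤ j - lo := by rw [ha'ℓ, hb]; omega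
    have hheavy' : ∀ k, k ≠ ℓ₀ → x ≤ g' k := by
      intro k hkℓ
      by_cases hkL : k ∈ L
      · rw [hL_g k hkL hkℓ]; exact hx1.le
      · rw [hU_g k ((hmemU k).2 hkL)]; exact hheavy k hkL
    have hcredit' : (2 * ((j - lo : ℕ) : ℝ)) < (∑ k ∈ (Finset.univ : Finset κ).erase ℓ₀, (a' k : ℝ) * g' k) +
        (a' ℓ₀ : ℝ) * ((g' ℓ₀ - x ^ 2) / (1 - x)) := by
      rw [hbudget_erase, ha'ℓ, hg'ℓ, Nat.cast_sub hloj]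
      have : ((hi - lo : ℕ) : ℝ) = (b : ℝ) := by rw [hb]
      rw [this] at hcredit
      linarith
    have key := dib_oneLight x hx0 hx1 a' g' (j - lo) hg'01 ℓ₀ hγlt haℓ hheavy' hcredit'
    have e : ∑ W : Finset κ, (∏ k, if k ∈ W then g' k else 1 - g' k) * (if j - lo + 1 ≤ ∑ k ∈ W, a' k then (1 : ℝ) else 0) =
        ∑ W : Finset κ, (∏ k, if k ∈ W then g' k else 1 - g' k) * (if j + 1 ≤ lo + ∑ k ∈ W, a' k then (1 : ℝ) else 0) := by
      refine Finset.sum_congr rfl fun W _ => ?_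
      have hiff : (j - lo + 1 ≤ ∑ k ∈ W, a' k) ↔ (j + 1 ≤ lo + ∑ k ∈ W, a' k) := by omega
      simp only [hiff]
    rw [e, hident] at key
    exact key

end IndepBlob

end Quant

end Summit.CriticalPhenomena.PercolationContinuityZ3.Theorems
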